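import Summits.BirchSwinnertonDyer.BirchSwinnertonDyer.Theorems.PrintX10bHowardContainmentAnyClassNumberX10bThm413Hyp
import Summits.BirchSwinnertonDyer.Rank1Residual.X9.LeafDischargeScalarImage
import Literature.NumberTheory.EllipticCurves.HeegnerEnvelopeCoherentPairProofs
import Literature.NumberTheory.EllipticCurves.HeegnerGeomCoherentDataOfFrameProofs
import Literature.NumberTheory.EllipticCurves.HeegnerCharIdealEnvelopeProofs
import Literature.NumberTheory.EllipticCurves.HeegnerCharIdealEnvelopePowTransferProofs
import Literature.NumberTheory.EllipticCurves.IwasawaSelmerDualProofs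
import HarnessLib

/-!
# Crux `BeyondCarrierDepthX10b` (stmt-BirchSwinnertonDyer-23055, PrintX10b aside r301), line «twins», skeleton
# v6.2: stub s2a `stub_envelope_divisibleClassNumber` (the Heegner-module ENVELOPE on the `3 ∣ h_K` X10b frames)
# BY SIGNATURE, modulo the cite-only facts CGLS 2022 Thm. 4.1.1 / Thm. 4.1.3 and the anticyclotomic tower

HONEST FRAMING (cell `run/shared/lean/pub/bsd-print-x9/`, LEAD seat bsd-line-x10b-p1 g3, D-0154 KEY row 10): THEOREMS
ONLY, helper `--supports 23055`; nothing booked, nothing closed; CONDITIONAL on three named inputs (gate: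
`proof.conditional`). «beyond-print theorem»: NO. BSD is not proved by any of this; no summit statement is proved by
this seat.

WHAT. `stub_envelope_divisibleClassNumber_of_coherentPair (hNV) (hCGLS) (hTw)` — the registered stub s2a of skeleton
v6.2 (`Cruxes/BeyondCarrierDepthX10b/Lines/twins.lean`, text `Stmt.envelopeDivisible`) VERBATIM: on every odd-`d_K`
X10b Heegner frame with `3 ∣ h_K` (`ClassX10 W p`, `¬ Surj W 3`, non-CM, `K` imaginary quadratic, `d_K` odd `≠ −3`,
(Heeg) for `N_E` and for `p`, `κ` anticyclotomic with topological generator `γ`), for the frame's own parametrisation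
datum `Dt` (`p ∤ c(Dt)`), Heegner datum `H`, embedding `jbar` and EVERY `Λ`-adic Selmer datum `D`, there are a CGLS
`d(k)`-shifted stabilised datum `C` and a Howard family `F`, BOTH on `Dt`, and `e` (here `e = 0`) with
`(p^e) · I(ℋ_∞(F)) ⊆ I(Λκ_∞(C))` and `𝔖/ℋ_∞(F)` torsion. It is the X10b INSTANTIATION of the cell's frame-generic
coherent-pair envelope (seat x9-p2, `exists_coherent_pair_envelope`: `ℋ_∞(F) ≤ Λκ_∞(C)` and `ω_δ · Λκ_∞(C) ≤ ℋ_∞(F)`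
at ANY class number), with the frame bookkeeping of the X10b row:
* the CGLS §3.2/§4.1 hypotheses by `X10.thm413Hypotheses_of_classX10` (x10b-p2; (h1) `E(K)[3] = 0` from
  irreducibility, good ordinary from `ClassX10`), `p ∤ N_E` by `ClassX10.not_dvd_conductorNorm`,
  `[K[p] : K[1]] = p − 1` by `card_ringClassGalOver_prime_one_of_frame` (x9-p1; `p` split, `d_K < −4`);
* torsion of `𝔖/Λκ_∞(C)` from `hNV` (CGLS Thm. 4.1.1 + Rem. 4.1.4 + §3.3, `isTorsion_quotient_stabilizedHeegnerModule_of_thm411`),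
  transported to `𝔖/ℋ_∞(F)` along the REVERSE envelope (`isTorsion_quotient_heegnerModule_of_smul_stabilizedHeegnerModule_le`);
* `𝔖` finitely generated from `hCGLS` (CGLS Thm. 4.1.3 (i), at the Selmer dual datum of
  `nonempty_selmerDualData_holds`), so that the tree's `Module.charIdeal` is monotone along the FORWARD envelope
  (`heegnerCharIdeal_le_stabilizedHeegnerCharIdeal_of_le`);
* the tower clause `K_k ⊆ K[p^{k+1}]` (`hTw`, the signature of PrintX9's support item `AnticyclotomicTowerSharp`,
  classical at every class number) feeds the construction of `C`.
The three hypotheses are exactly binders the rev-27 deciding cruxes of both Print routes already carry (NV by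
signature, CGLS 4.1.3 — a kernel consequence of CGS 6.5.2 by `thm413_of_thm652_stabilized` —, Tower♯); no statement at
`3 ∣ h_K` beyond them is used. After this file the crux's by-name residual in skeleton v6.2 is the μ-part s2c alone
(the μ-INEQUALITY `μ(X_tors) ≤ 2 μ(𝔖/ℋ_F)`, `PrintX10bBeyondCarrierV62Witnesses`), plus the cite-only facts.

References: [CastellaGrossiLeeSkinner2022] Thm. 4.1.1, Rem. 4.1.4, Thm. 4.1.3, §3.2–3.3 (arXiv:2008.02571v2);
[Howard2004HeegnerKolyvagin] §3.3, Thm. 3.3.7; [PerrinRiou1987BSMF] §1, §3.4 Prop. 10; [Cox2013] Cor. 7.28;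
skeleton v6.2 `Cruxes/BeyondCarrierDepthX10b/Lines/twins.lean`.
-/

-- the REGISTERED stub namespace `Summit.BirchSwinnertonDyer.BirchSwinnertonDyer.Cruxes.…` repeats the summit name
set_option linter.dupNamespace false
set_option autoImplicit false

noncomputable section

open scoped Classical Pointwise

open WeierstrassCurve NumberField Field Literature.NumberTheory.EllipticCurves
  Literature.NumberTheory.EllipticCurves.ModularForms Literature.NumberTheory.EllipticCurves.Rank1Residual
  Literature.NumberTheory.EllipticCurves.CastellaGrossiLeeSkinner2022

open Summit.BirchSwinnertonDyer.BirchSwinnertonDyer.Rank1Residual (X10.thm413Hypotheses_of_classX10)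

namespace Summit.BirchSwinnertonDyer.BirchSwinnertonDyer.Cruxes.BeyondCarrierDepthX10b.HowardFrames

/-- **v6.2 stub s2a BY SIGNATURE — the Heegner-module envelope on the `3 ∣ h_K` X10b frames, tied to `Dt`,
OUTPUT form — modulo the cite-only facts `hNV` (CGLS 2022 Thm. 4.1.1 + Rem. 4.1.4 + §3.3: `𝔖/Λκ_∞` torsion),
`hCGLS` (CGLS 2022 Thm. 4.1.3 (i): `𝔖` finitely generated) and the tower clause `hTw` (`K_k ⊆ K[p^{k+1}]`).**
For the given `jbar` and every `Λ`-adic Selmer datum `D` there are a CGLS `d(k)`-shifted stabilised datum `C`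
and a Howard family `F`, both on the frame's `Dt`, with `(p^0) · I(ℋ_∞(F)) ⊆ I(Λκ_∞(C))` and `𝔖/ℋ_∞(F)`
torsion: the coherent pair of `exists_coherent_pair_envelope` (x9-p2; `ℋ_∞(F) ≤ Λκ_∞(C)`,
`ω_δ · Λκ_∞(C) ≤ ℋ_∞(F)`), the X10b frame bookkeeping (`X10.thm413Hypotheses_of_classX10`,
`ClassX10.not_dvd_conductorNorm`, `card_ringClassGalOver_prime_one_of_frame`), torsion transport along the
reverse envelope and `Module.charIdeal` monotonicity along the forward one.
[cite: CastellaGrossiLeeSkinner2022, Thm. 4.1.1, Rem. 4.1.4 and Thm. 4.1.3 (i) (arXiv:2008.02571v2 TeX L2203–2294)]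
[cite: Howard2004HeegnerKolyvagin, §3.3 and Thm. 3.3.7] [cite: PerrinRiou1987BSMF, §3.4 Prop. 10] -/
theorem stub_envelope_divisibleClassNumber_of_coherentPair
    (hNV : thm411_torsionFree_heegnerClass_ne_bot_quotient_isTorsion.{0})
    (hCGLS : thm413_rankOne_charIdeal_torsion_dvd_localized.{0})
    (hTw : ∀ (K : Type) [Field K] [NumberField K] (p : ℕ) [Fact p.Prime], Odd p →
      Literature.NumberTheory.EllipticCurves.IsImaginaryQuadratic K →
      ∀ (κ : Literature.NumberTheory.EllipticCurves.ZpExtension K p), κ.IsAnticyclotomic →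
      ∀ (jbar : AlgebraicClosure K →+* ℂ) (k : ℕ),
      Literature.NumberTheory.EllipticCurves.ringClassSubgroup K (p ^ (k + 1)) jbar ≤ κ.layerSubgroup k) :
    ∀ (W : WeierstrassCurve ℚ) [W.IsElliptic] [W.IsGloballyMinimal] (p : ℕ) [Fact p.Prime]
    [NeZero (W.conductorNorm ℤ)] (K : Type) [Field K] [NumberField K],
    Literature.NumberTheory.EllipticCurves.Rank1Residual.ClassX10 W p →
    ¬ Literature.NumberTheory.EllipticCurves.Rank1Residual.Surj W 3 → ¬ W.HasCM →
    Literature.NumberTheory.EllipticCurves.IsImaginaryQuadratic K → Odd (NumberField.discr K) →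
    NumberField.discr K ≠ -3 →
    Literature.NumberTheory.EllipticCurves.SatisfiesHeegnerHypothesis (W.conductorNorm ℤ) K →
    Literature.NumberTheory.EllipticCurves.SatisfiesHeegnerHypothesis p K →
    p ∣ NumberField.classNumber K →
    ∀ (κ : Literature.NumberTheory.EllipticCurves.ZpExtension K p), κ.IsAnticyclotomic →
    ∀ (γ : Field.absoluteGaloisGroup K), κ.IsTopGenerator γ →
    ∀ (Dt : Literature.NumberTheory.EllipticCurves.ModularForms.ModularParametrizationData W
      (W.conductorNorm ℤ))
      (H : Literature.NumberTheory.EllipticCurves.HeegnerDatum (W.conductorNorm ℤ) (NumberField.discr K))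
      (jbar : AlgebraicClosure K →+* ℂ) (D : (W.baseChange K).LambdaAdicSelmerData κ γ),
    ¬ (p : ℤ) ∣ Dt.c →
    ∃ (C : Literature.NumberTheory.EllipticCurves.CastellaGrossiLeeSkinner2022.StabilizedHeegnerData
        (W.conductorNorm ℤ) W K κ jbar)
      (F : Literature.NumberTheory.EllipticCurves.HeegnerFamily (W.conductorNorm ℤ) W K κ jbar) (e : ℕ),
      C.Dt = Dt ∧ F.Dt = Dt ∧
      Ideal.span {((p : Literature.NumberTheory.EllipticCurves.IwasawaAlgebra p) ^ e)} *
          Literature.NumberTheory.EllipticCurves.heegnerCharIdeal D F ≤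
        Literature.NumberTheory.EllipticCurves.CastellaGrossiLeeSkinner2022.stabilizedHeegnerCharIdeal D C ∧
      Module.IsTorsion (Literature.NumberTheory.EllipticCurves.IwasawaAlgebra p)
        (D.S ⧸ Literature.NumberTheory.EllipticCurves.heegnerModule D F) := by
  intro W _ _ p _ _ K _ _ hX _ _ hK hodd h3 hHN hHp _ κ hκ γ hγ Dt H jbar D _
  have hp : p.Prime := Fact.out
  have hp_odd : Odd p := hp.odd_of_ne_two hX.ne_two
  have hyp := X10.thm413Hypotheses_of_classX10 hX hK h3 hHN hHp hodd hκ hγ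
  -- the coherent pair `(C, F)` on `(Dt, H.β)` with its two module inclusions (x9-p2's envelope engine)
  obtain ⟨C, F, hC, hF, -, -, hfwd, g, hg, hrev⟩ := exists_coherent_pair_envelope hK hHN Dt H.dvd_sq_sub jbar
    hyp.ordinary (ClassX10.not_dvd_conductorNorm hX) κ hγ (fun k ↦ hTw K p hp_odd hK κ hκ jbar k)
    (card_ringClassGalOver_prime_one_of_frame hK hodd h3 hp hHp jbar) hyp.noPTorsion D
  -- `𝔖/Λκ_∞(C)` torsion (Thm. 4.1.1), transported to `𝔖/ℋ_∞(F)` along `g • Λκ_∞(C) ≤ ℋ_∞(F)`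
  have htorC : Module.IsTorsion (IwasawaAlgebra p) (D.S ⧸ stabilizedHeegnerModule D C) :=
    isTorsion_quotient_stabilizedHeegnerModule_of_thm411 hNV hyp D C
  have htorF : Module.IsTorsion (IwasawaAlgebra p) (D.S ⧸ heegnerModule D F) :=
    isTorsion_quotient_heegnerModule_of_smul_stabilizedHeegnerModule_le D F C hg hrev htorC
  -- `𝔖` finitely generated (Thm. 4.1.3 (i), at any Selmer dual datum)
  obtain ⟨X⟩ := (W.baseChange K).nonempty_selmerDualData_holds κ γ hγ
  obtain ⟨⟨hfinS, -⟩, -, -⟩ := hCGLS (W.conductorNorm ℤ) W K p κ γ jbar hyp D C X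
  haveI := hfinS
  refine ⟨C, F, 0, hC, hF, ?_, htorF⟩
  rw [pow_zero, Ideal.span_singleton_one, Ideal.top_mul]
  exact heegnerCharIdeal_le_stabilizedHeegnerCharIdeal_of_le D F C htorF hfwd

end Summit.BirchSwinnertonDyer.BirchSwinnertonDyer.Cruxes.BeyondCarrierDepthX10b.HowardFrames

end
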